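import Summits.AtomisticToContinuum.Crystallization.Theorems.PalmUnimodularRigidityMinimiserShellsCapReduction

/-!
# Linear pricing of a local defect, necessity side: the finite linear inequality and the periodic gap
# (stub `stub_localDefectNecessity`, line `octahedral-annulus-mandate`)

Stub `stub_localDefectNecessity` of line `octahedral-annulus-mandate` of crux `MinimiserShells`
(stmt-AtomisticToContinuum-9225, route `PalmUnimodularRigidity`): the GENERIC form of the landed
`Cap.finite_cap_inequality_of_pricing`, which is its instance at the cap predicate `G := Cap.Capped`
(`finite_cap_inequality_of_pricing_eq_instance`).

Let `G` be ANY predicate of rooted configurations (`Measure ℝ³`), `δ` a hard core and `c ≥ 0`, and suppose the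
local-defect root event `{¬ G}` is priced linearly, `e* + c · P{μ | ¬ G μ} ≤ E_P[h]`, over all point-stationary
almost surely `δ`-hard-core probability laws `P` on rooted configurations.

* `stub_localDefectNecessity` (pricing ⇒ FINITE inequality, by exact uniform rooting): every finite injective
  `δ`-separated cluster `y : Fin N → ℝ³` satisfies `N·e* + c·#{i : ¬ G (cluster re-rooted at y i)} ≤ 𝓔_N(y)`, the
  defect count being read in `count|((· − y i) '' range y)`.  Proof, verbatim the one of the cap instance: the
  uniformly rooted law `P_y = (1/N) ∑ᵢ δ_{count|(range y − y i)}` is exactly point-stationary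
  (`isPointStationaryLaw_unifRooted`), almost surely `δ`-hard-core (`ae_isRootedHardCore_unifRooted`), has
  `E[h] = 𝓔_N(y)/N` (`meanRootEnergy_unifRooted`) and charges any event `A` with mass
  `≥ #{i : rootedMeasure y i ∈ A}/N` (`PricingContainment.natCard_le_mul_unifRooted_apply`); multiply the pricing
  inequality at `P_y` by `N`.  Corollaries: the family form `localDefectInequality_of_pricingFamily`
  (`∀ δ > 0 ∃ c > 0`), monotonicity in the hard core (`stub_localDefectNecessity_of_le`) and the pricing CEILING
  `pricingConstant_le` (`c ≤ (𝓔_N(y) − N·e*)/#defects` on every cluster with a defect).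
* `periodicGap_of_pricing` (pricing ⇒ PERIODIC gap): if moreover `G` is LOCAL at radius `2` and `c > 0`, pricing
  over almost surely `1/3`-hard-core laws gives, for every periodic `Q` with `1/3`-separated points and every `t`
  with `t·#motif ≤ #{x ∈ motif : ¬ G (rerooted Q x)}`, the gap `e* + c·t ≤ e(Q)` — literally
  `PricingToPeriodic.stub_pricingToPeriodic`; `periodicGap_of_pricing_of_radius_le` is the same for predicates
  local at any radius `r ≤ 2`, and `periodicGap_of_pricing_of_hardCore_le` for pricing at any hard core `δ ≤ 1/3`.

Nothing here is a published fact and no definition is introduced: these are elementary consequences of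
`Negative.UniformRooting`, `PricingContainment` and `PricingToPeriodic`.
-/

noncomputable section

open MeasureTheory
open scoped ENNReal BigOperators

namespace Summit.AtomisticToContinuum.Crystallization.Theorems.PalmUnimodularRigidityMinimiserShells.LocalDefectNecessity

open Literature.Probability.Process (IsPointStationaryLaw IsRootedHardCore)
open Literature.MathematicalPhysics.StatisticalMechanics (lennardJones rootEnergy interactionEnergy PeriodicConfiguration)
open Summit.AtomisticToContinuum.Crystallization.Theorems.MinimiserShells.Negative.LoadBearing (eStar meanRootEnergy)
open Summit.AtomisticToContinuum.Crystallization.Theorems.MinimiserShells.Negative.Rootedness (E3)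
open Summit.AtomisticToContinuum.Crystallization.Theorems.PalmUnimodularRigidityMinimiserShells.Residual (IsSepThird rerooted)
open Summit.AtomisticToContinuum.Crystallization.Theorems.MinimiserShells.Negative.UniformRooting
  (rootedMeasure unifRooted rootedMeasure_eq_range isProbabilityMeasure_unifRooted
   isPointStationaryLaw_unifRooted ae_isRootedHardCore_unifRooted meanRootEnergy_unifRooted)
open Summit.AtomisticToContinuum.Crystallization.Theorems.PalmUnimodularRigidityMinimiserShells.PricingContainment
  (natCard_le_mul_unifRooted_apply)

/-! ## Pricing ⇒ the finite linear local-defect inequality (exact uniform rooting) -/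

/-- **Linear pricing of a local defect is, on finite clusters, a LINEAR DEFECT INEQUALITY** (registered stub
`stub_localDefectNecessity`; necessity, by exact uniform rooting).  For ANY predicate `G` of rooted configurations,
if `c ≥ 0` prices the root event `{¬ G}` over point-stationary a.s. `δ`-hard-core probability laws,
`e* + c·P{¬ G} ≤ E_P[h]`, then every finite injective `δ`-separated configuration `y : Fin N → ℝ³` satisfies
`N·e* + c·#{i : ¬ G (y re-rooted at y i)} ≤ 𝓔_N(y)` (the defect read in `count|((· − y i) '' range y)`).  Proof: the
uniformly rooted law `P_y` is exactly point-stationary with `E_{P_y}[h] = 𝓔_N(y)/N` (`Negative.UniformRooting`) and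
charges the defect event with mass `≥ #defects/N` (`PricingContainment.natCard_le_mul_unifRooted_apply`). -/
theorem stub_localDefectNecessity :
    ∀ (G : Measure E3 → Prop) (δ c : ℝ), 0 ≤ c →
      (∀ P : Measure (Measure E3), IsProbabilityMeasure P → (∀ᵐ μ ∂P, IsRootedHardCore δ μ) →
        IsPointStationaryLaw P → eStar + c * (P {μ | ¬ G μ}).toReal ≤ meanRootEnergy P) →
      ∀ (N : ℕ) (y : Fin N → E3), Function.Injective y → (∀ i j : Fin N, i ≠ j → δ ≤ dist (y i) (y j)) →
        (N : ℝ) * eStar + c * (Nat.card {i : Fin N //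
            ¬ G ((Measure.count : Measure E3).restrict ((fun z => z - y i) '' Set.range y))} : ℝ) ≤
          interactionEnergy lennardJones y := by
  intro G δ c hc hprice N y hy hsep
  rcases Nat.eq_zero_or_pos N with hN | hN
  · subst hN
    have h0 : Nat.card {i : Fin 0 //
        ¬ G ((Measure.count : Measure E3).restrict ((fun z => z - y i) '' Set.range y))} = 0 :=
      Nat.card_of_isEmpty
    have hE : interactionEnergy lennardJones y = 0 := by
      unfold interactionEnergy; simp
    rw [h0, hE]
    simp
  · haveI : NeZero N := ⟨hN.ne'⟩
    have hNr : (0 : ℝ) < N := by exact_mod_cast hN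
    have hP : IsProbabilityMeasure (unifRooted y) := isProbabilityMeasure_unifRooted y
    have hcore : ∀ᵐ μ ∂(unifRooted y), IsRootedHardCore δ μ := ae_isRootedHardCore_unifRooted hsep
    have hstat : IsPointStationaryLaw (unifRooted y) := isPointStationaryLaw_unifRooted hy
    have hineq := hprice _ hP hcore hstat
    rw [meanRootEnergy_unifRooted hy] at hineq
    -- the defect count is charged by `P_y`
    have h1 := natCard_le_mul_unifRooted_apply y {μ | ¬ G μ}
    have h2 : Nat.card {i : Fin N //
          ¬ G ((Measure.count : Measure E3).restrict ((fun z => z - y i) '' Set.range y))} =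
        Nat.card {i : Fin N // rootedMeasure y i ∈ {μ | ¬ G μ}} := by
      refine Nat.card_congr (Equiv.subtypeEquivRight fun i => ?_)
      have hset : (fun z => z - y i) '' Set.range y = Set.range fun k => y k - y i := by
        ext w
        simp only [Set.mem_image, Set.mem_range, exists_exists_eq_and]
      rw [Set.mem_setOf_eq, rootedMeasure_eq_range, hset]
    rw [h2]
    have h3 : c * (Nat.card {i : Fin N // rootedMeasure y i ∈ {μ | ¬ G μ}} : ℝ) ≤
        c * ((N : ℝ) * ((unifRooted y) {μ | ¬ G μ}).toReal) := mul_le_mul_of_nonneg_left h1 hc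
    have h4 : (N : ℝ) * (eStar + c * ((unifRooted y) {μ | ¬ G μ}).toReal) ≤
        interactionEnergy lennardJones y := by
      rw [← le_div_iff₀' hNr]
      exact hineq
    nlinarith [h3, h4]

/-- **The cap instance**: `Cap.finite_cap_inequality_of_pricing` (landed) is `stub_localDefectNecessity` at
`G := Cap.Capped` — re-derived here from the generic statement, as a consistency check of the two forms. -/
theorem finite_cap_inequality_of_pricing_eq_instance {δ c : ℝ}
    (hprice : ∀ P : Measure (Measure E3), IsProbabilityMeasure P →
      (∀ᵐ μ ∂P, IsRootedHardCore δ μ) → IsPointStationaryLaw P →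
      eStar + c * (P {μ | ¬ Cap.Capped μ}).toReal ≤ meanRootEnergy P)
    (hc : 0 ≤ c) {N : ℕ} (y : Fin N → E3) (hy : Function.Injective y)
    (hsep : ∀ i j : Fin N, i ≠ j → δ ≤ dist (y i) (y j)) :
    (N : ℝ) * eStar + c * (Nat.card {i : Fin N //
        ¬ Cap.Capped ((Measure.count : Measure E3).restrict ((fun z => z - y i) '' Set.range y))} : ℝ) ≤
      interactionEnergy lennardJones y :=
  stub_localDefectNecessity Cap.Capped δ c hc hprice N y hy hsep

/-- **Monotonicity in the hard core**: pricing over a.s. `δ`-hard-core laws gives the finite inequality on every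
injective `δ'`-separated cluster with `δ ≤ δ'` (a `δ'`-separated cluster is `δ`-separated). -/
theorem stub_localDefectNecessity_of_le (G : Measure E3 → Prop) {δ δ' c : ℝ} (hδ : δ ≤ δ') (hc : 0 ≤ c)
    (hprice : ∀ P : Measure (Measure E3), IsProbabilityMeasure P →
      (∀ᵐ μ ∂P, IsRootedHardCore δ μ) → IsPointStationaryLaw P →
      eStar + c * (P {μ | ¬ G μ}).toReal ≤ meanRootEnergy P)
    {N : ℕ} (y : Fin N → E3) (hy : Function.Injective y)
    (hsep : ∀ i j : Fin N, i ≠ j → δ' ≤ dist (y i) (y j)) :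
    (N : ℝ) * eStar + c * (Nat.card {i : Fin N //
        ¬ G ((Measure.count : Measure E3).restrict ((fun z => z - y i) '' Set.range y))} : ℝ) ≤
      interactionEnergy lennardJones y :=
  stub_localDefectNecessity G δ c hc hprice N y hy fun i j hij => hδ.trans (hsep i j hij)

/-- **Pricing at a SMALLER hard core is stronger**: a pricing inequality over a.s. `δ`-hard-core laws holds over
a.s. `δ'`-hard-core laws for every `δ ≤ δ'` (`IsRootedHardCore.mono`). -/
theorem pricing_mono (G : Measure E3 → Prop) {δ δ' c : ℝ} (hδ : δ ≤ δ')
    (hprice : ∀ P : Measure (Measure E3), IsProbabilityMeasure P →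
      (∀ᵐ μ ∂P, IsRootedHardCore δ μ) → IsPointStationaryLaw P →
      eStar + c * (P {μ | ¬ G μ}).toReal ≤ meanRootEnergy P) :
    ∀ P : Measure (Measure E3), IsProbabilityMeasure P →
      (∀ᵐ μ ∂P, IsRootedHardCore δ' μ) → IsPointStationaryLaw P →
      eStar + c * (P {μ | ¬ G μ}).toReal ≤ meanRootEnergy P :=
  fun P hP hcore hstat => hprice P hP (hcore.mono fun _ hμ => hμ.mono hδ) hstat

/-- **The family form** (`∀ δ > 0 ∃ c > 0`, as in `Cap.finite_cap_inequality_of_capPricing`): if for every hard core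
`δ > 0` some `c > 0` prices the defect event `{¬ G}`, then for every `δ > 0` some `c > 0` makes every finite
injective `δ`-separated cluster satisfy the linear defect inequality `N·e* + c·#defects ≤ 𝓔_N` — with the SAME
constant `c(δ)`. -/
theorem localDefectInequality_of_pricingFamily (G : Measure E3 → Prop)
    (h : ∀ δ : ℝ, 0 < δ → ∃ c : ℝ, 0 < c ∧ ∀ P : Measure (Measure E3), IsProbabilityMeasure P →
      (∀ᵐ μ ∂P, IsRootedHardCore δ μ) → IsPointStationaryLaw P →
      eStar + c * (P {μ | ¬ G μ}).toReal ≤ meanRootEnergy P) :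
    ∀ δ : ℝ, 0 < δ → ∃ c : ℝ, 0 < c ∧ ∀ (N : ℕ) (y : Fin N → E3), Function.Injective y →
      (∀ i j : Fin N, i ≠ j → δ ≤ dist (y i) (y j)) →
      (N : ℝ) * eStar + c * (Nat.card {i : Fin N //
          ¬ G ((Measure.count : Measure E3).restrict ((fun z => z - y i) '' Set.range y))} : ℝ) ≤
        interactionEnergy lennardJones y := by
  intro δ hδ
  obtain ⟨c, hc, hprice⟩ := h δ hδ
  exact ⟨c, hc, fun N y hy hsep => stub_localDefectNecessity G δ c hc.le hprice N y hy hsep⟩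

/-- **The finite pricing CEILING**: a pricing constant `c ≥ 0` of the defect event `{¬ G}` over a.s. `δ`-hard-core
laws is at most `(𝓔_N(y) − N·e*)/#defects(y)` for every finite injective `δ`-separated cluster `y` with at least one
defect — the finite quantity a refuter or a certificate designer works against. -/
theorem pricingConstant_le (G : Measure E3 → Prop) {δ c : ℝ} (hc : 0 ≤ c)
    (hprice : ∀ P : Measure (Measure E3), IsProbabilityMeasure P →
      (∀ᵐ μ ∂P, IsRootedHardCore δ μ) → IsPointStationaryLaw P →
      eStar + c * (P {μ | ¬ G μ}).toReal ≤ meanRootEnergy P)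
    {N : ℕ} (y : Fin N → E3) (hy : Function.Injective y)
    (hsep : ∀ i j : Fin N, i ≠ j → δ ≤ dist (y i) (y j))
    (hdef : 0 < Nat.card {i : Fin N //
        ¬ G ((Measure.count : Measure E3).restrict ((fun z => z - y i) '' Set.range y))}) :
    c ≤ (interactionEnergy lennardJones y - (N : ℝ) * eStar) / (Nat.card {i : Fin N //
        ¬ G ((Measure.count : Measure E3).restrict ((fun z => z - y i) '' Set.range y))} : ℝ) := by
  have h := stub_localDefectNecessity G δ c hc hprice N y hy hsep
  have hk : (0 : ℝ) < (Nat.card {i : Fin N //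
      ¬ G ((Measure.count : Measure E3).restrict ((fun z => z - y i) '' Set.range y))} : ℝ) := by
    exact_mod_cast hdef
  rw [le_div_iff₀ hk]
  linarith

/-! ## Pricing ⇒ the periodic gap (radius-`2` local predicates) -/

/-- **Linear pricing of a radius-`2` local defect is a PERIODIC GAP** (literally the landed
`PricingToPeriodic.stub_pricingToPeriodic`, p130734).  If `G` is local at radius `2` (two rooted configurations with
the same atoms in the closed ball `B̄(0, 2)` get the same verdict) and `c > 0` prices `{¬ G}` over point-stationary
a.s. `1/3`-hard-core probability laws, then every periodic configuration `Q` of `ℝ³` with `1/3`-separated points and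
at least `t·#motif` motif sites `x` failing `G` (read in `Q.points` re-rooted at `x`) has `e* + c·t ≤ e(Q)`. -/
theorem periodicGap_of_pricing (G : Measure E3 → Prop)
    (hloc : ∀ μ ν : Measure E3, (∀ w : E3, ‖w‖ ≤ 2 → (μ {w} ≠ 0 ↔ ν {w} ≠ 0)) → (G μ ↔ G ν))
    {c : ℝ} (hc : 0 < c)
    (hprice : ∀ P : Measure (Measure E3), IsProbabilityMeasure P →
      (∀ᵐ μ ∂P, IsRootedHardCore (1 / 3) μ) → IsPointStationaryLaw P →
      eStar + c * (P {μ | ¬ G μ}).toReal ≤ meanRootEnergy P) :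
    ∀ Q : PeriodicConfiguration 3, IsSepThird Q → ∀ t : ℝ,
      t * (Q.motif.card : ℝ) ≤ (Nat.card {x : Q.motif // ¬ G (rerooted Q (x : E3))} : ℝ) →
      eStar + c * t ≤ Q.energyPerParticle lennardJones :=
  PricingToPeriodic.stub_pricingToPeriodic G hloc c hc hprice

/-- **The same for predicates local at any radius `r ≤ 2`** (a radius-`r` local predicate is radius-`2` local when
`r ≤ 2`: weaken the locality hypothesis). -/
theorem periodicGap_of_pricing_of_radius_le (G : Measure E3 → Prop) {r : ℝ} (hr : r ≤ 2)
    (hloc : ∀ μ ν : Measure E3, (∀ w : E3, ‖w‖ ≤ r → (μ {w} ≠ 0 ↔ ν {w} ≠ 0)) → (G μ ↔ G ν))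
    {c : ℝ} (hc : 0 < c)
    (hprice : ∀ P : Measure (Measure E3), IsProbabilityMeasure P →
      (∀ᵐ μ ∂P, IsRootedHardCore (1 / 3) μ) → IsPointStationaryLaw P →
      eStar + c * (P {μ | ¬ G μ}).toReal ≤ meanRootEnergy P) :
    ∀ Q : PeriodicConfiguration 3, IsSepThird Q → ∀ t : ℝ,
      t * (Q.motif.card : ℝ) ≤ (Nat.card {x : Q.motif // ¬ G (rerooted Q (x : E3))} : ℝ) →
      eStar + c * t ≤ Q.energyPerParticle lennardJones :=
  periodicGap_of_pricing G (fun μ ν h => hloc μ ν fun w hw => h w (hw.trans hr)) hc hprice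

/-- **The same from pricing at any hard core `δ ≤ 1/3`** (pricing over a.s. `δ`-hard-core laws is pricing over
a.s. `1/3`-hard-core laws, `pricing_mono`), for predicates local at any radius `r ≤ 2`. -/
theorem periodicGap_of_pricing_of_hardCore_le (G : Measure E3 → Prop) {r : ℝ} (hr : r ≤ 2)
    (hloc : ∀ μ ν : Measure E3, (∀ w : E3, ‖w‖ ≤ r → (μ {w} ≠ 0 ↔ ν {w} ≠ 0)) → (G μ ↔ G ν))
    {δ c : ℝ} (hδ : δ ≤ 1 / 3) (hc : 0 < c)
    (hprice : ∀ P : Measure (Measure E3), IsProbabilityMeasure P →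
      (∀ᵐ μ ∂P, IsRootedHardCore δ μ) → IsPointStationaryLaw P →
      eStar + c * (P {μ | ¬ G μ}).toReal ≤ meanRootEnergy P) :
    ∀ Q : PeriodicConfiguration 3, IsSepThird Q → ∀ t : ℝ,
      t * (Q.motif.card : ℝ) ≤ (Nat.card {x : Q.motif // ¬ G (rerooted Q (x : E3))} : ℝ) →
      eStar + c * t ≤ Q.energyPerParticle lennardJones :=
  periodicGap_of_pricing_of_radius_le G hr hloc hc (pricing_mono G hδ hprice)

/-- **Both consequences at once**: a radius-`r`-local (`r ≤ 2`) defect priced with `c > 0` at a hard core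
`δ ≤ 1/3` satisfies the finite linear defect inequality on every injective `δ`-separated cluster AND the periodic gap
`e* + c·t ≤ e(Q)` on every `1/3`-separated periodic configuration with defect fraction `≥ t`. -/
theorem finiteInequality_and_periodicGap_of_pricing (G : Measure E3 → Prop) {r : ℝ} (hr : r ≤ 2)
    (hloc : ∀ μ ν : Measure E3, (∀ w : E3, ‖w‖ ≤ r → (μ {w} ≠ 0 ↔ ν {w} ≠ 0)) → (G μ ↔ G ν))
    {δ c : ℝ} (hδ : δ ≤ 1 / 3) (hc : 0 < c)
    (hprice : ∀ P : Measure (Measure E3), IsProbabilityMeasure P →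
      (∀ᵐ μ ∂P, IsRootedHardCore δ μ) → IsPointStationaryLaw P →
      eStar + c * (P {μ | ¬ G μ}).toReal ≤ meanRootEnergy P) :
    (∀ (N : ℕ) (y : Fin N → E3), Function.Injective y → (∀ i j : Fin N, i ≠ j → δ ≤ dist (y i) (y j)) →
      (N : ℝ) * eStar + c * (Nat.card {i : Fin N //
          ¬ G ((Measure.count : Measure E3).restrict ((fun z => z - y i) '' Set.range y))} : ℝ) ≤
        interactionEnergy lennardJones y) ∧
    ∀ Q : PeriodicConfiguration 3, IsSepThird Q → ∀ t : ℝ,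
      t * (Q.motif.card : ℝ) ≤ (Nat.card {x : Q.motif // ¬ G (rerooted Q (x : E3))} : ℝ) →
      eStar + c * t ≤ Q.energyPerParticle lennardJones :=
  ⟨stub_localDefectNecessity G δ c hc.le hprice, periodicGap_of_pricing_of_hardCore_le G hr hloc hδ hc hprice⟩

end Summit.AtomisticToContinuum.Crystallization.Theorems.PalmUnimodularRigidityMinimiserShells.LocalDefectNecessity

end
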